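/-
Copyright: derived here (Resolution Observatory cell `pub-rosobs`, carver gen 56). AI-written Lean; AI review is weaker than expert
review.  Companion file of the cell's POLYNOMIAL weighted-centre model `W(f)`: the two pure-algebra cores of engine 1's LEMMA FC
("Fermat-curve composition": inside BOOTSTRAP⁺ the least pure exponent is a power of `p`; THEOREM-FC-eng1-g37 §4 (B2), (B5);
CARVER-NOTES-eng1-g37 T48a, T48b).
Instrument — NOT a resolution theorem and NOT a statement about the invariant of [AbramovichTemkinWlodarczyk2024].
-/
import Mathlib.Algebra.Polynomial.Monic
import Mathlib.Algebra.Polynomial.Coeff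
import Mathlib.Algebra.Polynomial.Degree.Operations
import Mathlib.RingTheory.AdjoinRoot
import Mathlib.Algebra.CharP.Lemmas
import Mathlib.Algebra.Ring.GeomSum
import Mathlib.Data.Fin.Tuple.NatAntidiagonal
import Mathlib.Algebra.Regular.SMul
import Mathlib.Algebra.BigOperators.Fin
import Mathlib.Algebra.Module.Defs
import Mathlib.Tactic.Ring
import Mathlib.Tactic.FinCases
import HarnessLib

/-!
# Fermat-curve composition: the constants `u_k = 1 + t^k + s^k` modulo `1 + t^m + s^m`, and the word induction

Two self-contained algebraic facts behind engine 1's LEMMA FC (W(f) toy model; all modelling is the engine's).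

**(B2) The constants.**  In `K[t][s] = K[X][X]` (inner variable `t`, outer variable `s`) put
`fermat m := s^m + (1 + t^m)` — the affine Fermat polynomial `1 + t^m + s^m`, MONIC of degree `m` in `s` over `K[t]` — so that
also `u_k := 1 + t^k + s^k = fermat k`.  Then
* `not_fermat_dvd_fermat` : if `m ∤ k` (`0 < m`, `K` non-trivial) then `fermat m ∤ fermat k`: with `k = m·a + r`, `0 < r < m`,
  `fermat k ≡ (1 + t^k) + (−1 − t^m)^a · s^r (mod fermat m)` and the right-hand side is a NON-ZERO polynomial of `s`-degree
  `r < m` (its `s^r`-coefficient `(−1 − t^m)^a = ±(monic)^a` is non-zero), which the monic `fermat m` of degree `m` cannot divide;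
  equivalently `u_k ≠ 0` in `B′ := K[t][s]/(fermat m) = AdjoinRoot (fermat m)` (`mk_fermat_ne_zero`; `mk_fermat` : `u_k = 1 + t^k + s^k`
  there);
* `fermat_mul_char_pow` / `fermat_dvd_fermat_mul_char_pow` : in characteristic `p`, `fermat (m·p^e) = (fermat m)^{p^e}` (Frobenius
  additivity), so `fermat m ∣ fermat (m·p^e)` and `u_{m p^e} = 0` in `B′` (`mk_fermat_mul_char_pow`).

**(B5) The word induction.**  `N` an additive monoid (cell: `k[ε]`), `M` an `R`-module (cell: `R = k[[s]]`, `M = R[ε]`) with an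
injective additive `ι : N → M`, additive operators `E k : N → N` (`k : ℕ`) with `E 0 = id` (cell: the `σ^k`-components of the
substitution), three scalars `l : Fin 3 → R` (cell: `(1, t(s), s)`) with power sums `powerSum l k = Σ_a (l a)^k` (`= u_k`).
The ORDER-`k` COMPONENT of the triple composite is
`orderComp E l ι k f = Σ_{x : Fin 3 → ℕ, Σ x = k} (Π_a (l a)^{x a}) • ι (E (x 2) (E (x 1) (E (x 0) f)))`.
* `map_eq_zero_of_orderComp_eq_zero` (**FC (B5) CLAIM**): if `orderComp E l ι k = 0` for every `k` with `m ∤ k` and `powerSum l k`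
  is `M`-regular for every such `k`, then `E k = 0` for every `k` with `m ∤ k`.  Strong induction on `k`: a word containing an
  index `k′ ∉ {0, k} ∪ mℕ` dies by induction (`k′ < k`); in a surviving word every index is `≡ 0 (mod m)` or `= k`, and as
  `m ∤ k = Σ indices` exactly one index is `k`, the others `0` — the three survivors give `u_k • ι (E k f) = 0`
  (`orderComp_eq_powerSum_smul`).

What is NOT here (engine 1's modelling, THEOREM-FC-eng1-g37 §4): the Hensel branch `t(s)`, the injectivity `B′ ↪ k[[s]]` of (B1),
LEMMA CP / PR″ and the free hypotheses giving `Θ = id` (B3)–(B4), and the re-grading conclusion (B6) (for "coefficients vanish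
off `mℕ` ⇒ polynomial in `σ^m`" see `WeightedBlowup.expand_contract_of_coeff` in `WeightedCentreEvenReparam`).

Pattern cites: Euclidean division by a monic polynomial and Frobenius additivity [cite: Lang2002, Ch. IV §1]; words in the
components of a higher derivation [cite: Matsumura1987, §27 (pp. 207–209)].  Formalisation and statements ours, elementary.
-/

namespace Literature.AlgebraicGeometry.Resolution.WeightedBlowup.FermatComposition

open Polynomial

/-! ## (B2) The constants `u_k` modulo the Fermat polynomial -/

section Constants

variable {K : Type*} [CommRing K]

/-- The affine Fermat polynomial `1 + t^m + s^m ∈ K[t][s]`, as a polynomial in the OUTER variable `s` over `K[t]`: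
`fermat m = X ^ m + C (1 + X ^ m)`; the constants `u_k = 1 + t^k + s^k` are `fermat k` (ours). [cite: Lang2002, Ch. IV §1] -/
noncomputable def fermat (m : ℕ) : K[X][X] := X ^ m + C (1 + X ^ m)

/-- `fermat m` unfolded (plumbing). [cite: Lang2002, Ch. IV §1] -/
theorem fermat_def (m : ℕ) : (fermat m : K[X][X]) = X ^ m + C (1 + X ^ m) := rfl

/-- `fermat m` is monic in `s` for `0 < m` (ours). [cite: Lang2002, Ch. IV §1] -/
theorem fermat_monic {m : ℕ} (hm : 0 < m) : (fermat m : K[X][X]).Monic :=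
  monic_X_pow_add_C _ (Nat.pos_iff_ne_zero.mp hm)

/-- `fermat m` has `s`-degree `m` (ours). [cite: Lang2002, Ch. IV §1] -/
theorem natDegree_fermat [Nontrivial K] (m : ℕ) : (fermat m : K[X][X]).natDegree = m := by
  rw [fermat_def]
  exact natDegree_X_pow_add_C

/-- A power of `−(1 + t^m)` is non-zero in `K[t]` for `0 < m` and `K` non-trivial: it is `±` a monic polynomial (plumbing).
[cite: Lang2002, Ch. IV §1] -/
theorem neg_one_add_X_pow_pow_ne_zero [Nontrivial K] {m : ℕ} (hm : 0 < m) (a : ℕ) :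
    (-(1 + X ^ m) : K[X]) ^ a ≠ 0 := by
  have hmon : ((1 : K[X]) + X ^ m).Monic := by
    rw [add_comm, ← map_one C]
    exact monic_X_pow_add_C _ (Nat.pos_iff_ne_zero.mp hm)
  rw [neg_pow]
  intro h
  exact (hmon.pow a).ne_zero (((isUnit_one.neg).pow a).mul_right_eq_zero.mp h)

/-- **FC (B2), `u_k ≠ 0`** (ours): for `m ∤ k` (`0 < m`, `K` non-trivial) the Fermat polynomial `1 + t^m + s^m` does NOT divide
`1 + t^k + s^k` in `K[t][s]`.  Proof: `k = m·a + r` with `0 < r < m`; modulo `fermat m = s^m − (−1 − t^m)` one has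
`s^k ≡ (−1 − t^m)^a s^r`, so `fermat m` would divide `W = (1 + t^k) + (−1 − t^m)^a s^r ≠ 0` of `s`-degree `r < m` — impossible
for a monic polynomial of degree `m`. [cite: Lang2002, Ch. IV §1] -/
theorem not_fermat_dvd_fermat [Nontrivial K] {m k : ℕ} (hm : 0 < m) (hmk : ¬ m ∣ k) :
    ¬ (fermat m : K[X][X]) ∣ fermat k := by
  intro hdvd
  set a := k / m with ha
  set r := k % m with hr
  have hr0 : r ≠ 0 := fun h => hmk (Nat.dvd_of_mod_eq_zero h)
  have hrm : r < m := Nat.mod_lt k hm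
  have hk : k = m * a + r := (Nat.div_add_mod k m).symm
  set c : K[X] := -(1 + X ^ m) with hc
  have hfm : (fermat m : K[X][X]) = X ^ m - C c := by
    rw [fermat_def, hc, map_neg, sub_neg_eq_add]
  have hXk : (X : K[X][X]) ^ k = (X ^ m) ^ a * X ^ r := by
    rw [← pow_mul, ← pow_add, ← hk]
  -- the witness of small degree
  set W : K[X][X] := C (c ^ a) * X ^ r + C (1 + X ^ k) with hW
  have hW_eq : fermat k - X ^ r * ((X ^ m) ^ a - (C c) ^ a) = W := by
    rw [hW, map_pow, fermat_def, hXk]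
    ring
  have h2 : (fermat m : K[X][X]) ∣ X ^ r * ((X ^ m) ^ a - (C c) ^ a) := by
    rw [hfm]
    exact dvd_mul_of_dvd_right (sub_dvd_pow_sub_pow _ _ a) _
  have hWdvd : (fermat m : K[X][X]) ∣ W := by
    rw [← hW_eq]
    exact dvd_sub hdvd h2
  -- `W ≠ 0`: its `s^r`-coefficient is `c^a ≠ 0`
  have hWr : W.coeff r = c ^ a := by
    rw [hW, coeff_add, coeff_C_mul_X_pow, if_pos rfl, coeff_C, if_neg hr0, add_zero]
  have hW0 : W ≠ 0 := by
    intro h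
    have := neg_one_add_X_pow_pow_ne_zero (K := K) hm a
    rw [← hc, ← hWr, h, coeff_zero] at this
    exact this rfl
  -- `natDegree W ≤ r < m`
  have hWdeg : W.natDegree < (fermat m : K[X][X]).natDegree := by
    rw [natDegree_fermat]
    refine lt_of_le_of_lt ?_ hrm
    rw [hW]
    refine (natDegree_add_le _ _).trans (max_le (natDegree_C_mul_X_pow_le _ _) ?_)
    rw [natDegree_C]
    exact Nat.zero_le _
  exact (fermat_monic hm).not_dvd_of_natDegree_lt hW0 hWdeg hWdvd

/-- **FC (B2), Frobenius additivity** (ours): in characteristic `p`, `1 + t^{m p^e} + s^{m p^e} = (1 + t^m + s^m)^{p^e}` in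
`K[t][s]`. [cite: Lang2002, Ch. IV §1] -/
theorem fermat_mul_char_pow (p : ℕ) [Fact p.Prime] [CharP K p] (m e : ℕ) :
    (fermat (m * p ^ e) : K[X][X]) = fermat m ^ p ^ e := by
  have h1 : ((X : K[X][X]) ^ m + C (1 + X ^ m)) ^ p ^ e = (X ^ m) ^ p ^ e + (C (1 + X ^ m)) ^ p ^ e :=
    add_pow_char_pow _ _ _ _
  have h2 : ((1 : K[X]) + X ^ m) ^ p ^ e = 1 + (X ^ m) ^ p ^ e := by
    rw [add_pow_char_pow, one_pow]
  rw [fermat_def, fermat_def, h1, ← map_pow, h2, ← pow_mul, ← pow_mul]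

/-- Hence `1 + t^m + s^m ∣ 1 + t^{m p^e} + s^{m p^e}` in characteristic `p` (ours). [cite: Lang2002, Ch. IV §1] -/
theorem fermat_dvd_fermat_mul_char_pow (p : ℕ) [Fact p.Prime] [CharP K p] (m e : ℕ) :
    (fermat m : K[X][X]) ∣ fermat (m * p ^ e) := by
  rw [fermat_mul_char_pow p m e]
  exact dvd_pow_self _ (pow_ne_zero e (Fact.out : p.Prime).ne_zero)

/-- In `B′ = K[t][s]/(1 + t^m + s^m) = AdjoinRoot (fermat m)`, with `t = of (fermat m) X` and `s = root (fermat m)`: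
`u_k := mk (fermat k) = s^k + (1 + t^k)` (plumbing). [cite: Lang2002, Ch. IV §1] -/
theorem mk_fermat (m k : ℕ) :
    AdjoinRoot.mk (fermat m : K[X][X]) (fermat k) =
      AdjoinRoot.root (fermat m) ^ k + AdjoinRoot.of (fermat m) (1 + X ^ k) := by
  rw [fermat_def k, map_add, map_pow, AdjoinRoot.mk_X, AdjoinRoot.mk_C]

/-- **FC (B2) in `B′`** (ours): `u_k ≠ 0` in `B′ = K[t][s]/(1 + t^m + s^m)` whenever `m ∤ k` (`0 < m`, `K` non-trivial).
[cite: Lang2002, Ch. IV §1] -/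
theorem mk_fermat_ne_zero [Nontrivial K] {m k : ℕ} (hm : 0 < m) (hmk : ¬ m ∣ k) :
    AdjoinRoot.mk (fermat m : K[X][X]) (fermat k) ≠ 0 := by
  rw [Ne, AdjoinRoot.mk_eq_zero]
  exact not_fermat_dvd_fermat hm hmk

/-- … while `u_{m p^e} = 0` in `B′` in characteristic `p` (ours). [cite: Lang2002, Ch. IV §1] -/
theorem mk_fermat_mul_char_pow (p : ℕ) [Fact p.Prime] [CharP K p] (m e : ℕ) :
    AdjoinRoot.mk (fermat m : K[X][X]) (fermat (m * p ^ e)) = 0 :=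
  AdjoinRoot.mk_eq_zero.mpr (fermat_dvd_fermat_mul_char_pow p m e)

/-- The zero set of `k ↦ u_k` in `B′` (`0 < m`, `K` non-trivial) is contained in `mℕ`; this and the previous lemma are the part
of fc37a PART 1 that the proof uses (ours). [cite: Lang2002, Ch. IV §1] -/
theorem dvd_of_mk_fermat_eq_zero [Nontrivial K] {m k : ℕ} (hm : 0 < m)
    (h : AdjoinRoot.mk (fermat m : K[X][X]) (fermat k) = 0) : m ∣ k := by
  by_contra hmk
  exact mk_fermat_ne_zero hm hmk h

end Constants

/-! ## (B5) The word induction -/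

section Words

variable {R : Type*} [CommRing R] {M : Type*} [AddCommGroup M] [Module R M] {N : Type*} [AddCommMonoid N]

/-- The word `E_{x 2} ∘ E_{x 1} ∘ E_{x 0}` attached to a triple of indices `x : Fin 3 → ℕ` (ours; the order of the three factors is a
convention — THEOREM-FC §4 (B5) notes nothing depends on it). [cite: Matsumura1987, §27 (pp. 207–209)] -/
def word (E : ℕ → N →+ N) (x : Fin 3 → ℕ) : N →+ N := (E (x 2)).comp ((E (x 1)).comp (E (x 0)))

/-- `word E x f = E (x 2) (E (x 1) (E (x 0) f))` (plumbing). [cite: Matsumura1987, §27 (pp. 207–209)] -/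
@[simp] theorem word_apply (E : ℕ → N →+ N) (x : Fin 3 → ℕ) (f : N) :
    word E x f = E (x 2) (E (x 1) (E (x 0) f)) := rfl

/-- The monomial `Π_a (l a)^{x a} = λ₁^{x 0} λ₂^{x 1} λ₃^{x 2}` (ours). [cite: Matsumura1987, §27 (pp. 207–209)] -/
def mono (l : Fin 3 → R) (x : Fin 3 → ℕ) : R := ∏ a, l a ^ x a

/-- The power sum `u_k = Σ_a (l a)^k` (ours; cell: `1 + t(s)^k + s^k`). [cite: Matsumura1987, §27 (pp. 207–209)] -/
def powerSum (l : Fin 3 → R) (k : ℕ) : R := ∑ a, l a ^ k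

/-- The ORDER-`k` COMPONENT of the triple composite `Φ_{λ₁τ} Φ_{λ₂τ} Φ_{λ₃τ}` applied to `f`:
`Σ_{i+j+l = k} λ₁^i λ₂^j λ₃^l • ι (E_l (E_j (E_i f)))` (ours; relation `(E_k)` of THEOREM-FC §4 (B5) says it vanishes).
[cite: Matsumura1987, §27 (pp. 207–209)] -/
def orderComp (E : ℕ → N →+ N) (l : Fin 3 → R) (ι : N →+ M) (k : ℕ) (f : N) : M :=
  ∑ x ∈ Finset.Nat.antidiagonalTuple 3 k, mono l x • ι (word E x f)

/-- `mono l (single a k) = (l a)^k` (plumbing). [cite: Matsumura1987, §27 (pp. 207–209)] -/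
theorem mono_single (l : Fin 3 → R) (k : ℕ) (a : Fin 3) : mono l (Pi.single a k) = l a ^ k := by
  unfold mono
  rw [Finset.prod_eq_single a (fun b _ hb => by rw [Pi.single_eq_of_ne hb, pow_zero])
    (fun h => absurd (Finset.mem_univ a) h), Pi.single_eq_same]

/-- `word E (single a k) = E k` when `E 0 = id` (plumbing). [cite: Matsumura1987, §27 (pp. 207–209)] -/
theorem word_single {E : ℕ → N →+ N} (hE0 : E 0 = AddMonoidHom.id N) (k : ℕ) (a : Fin 3) :
    word E (Pi.single a k) = E k := by
  ext f
  fin_cases a <;> simp [hE0]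

/-- `Σ_b single a k b = k` (plumbing). [cite: Matsumura1987, §27 (pp. 207–209)] -/
theorem sum_single (k : ℕ) (a : Fin 3) : ∑ b, (Pi.single a k : Fin 3 → ℕ) b = k := by
  rw [Finset.sum_eq_single a (fun b _ hb => Pi.single_eq_of_ne hb _) (fun h => absurd (Finset.mem_univ a) h),
    Pi.single_eq_same]

/-- `a ↦ single a k` is injective for `k ≠ 0` (plumbing). [cite: Matsumura1987, §27 (pp. 207–209)] -/
theorem single_index_injective {k : ℕ} (hk : k ≠ 0) {a b : Fin 3}
    (h : (Pi.single a k : Fin 3 → ℕ) = Pi.single b k) : a = b := by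
  by_contra hab
  have h' := congr_fun h a
  rw [Pi.single_eq_same, Pi.single_eq_of_ne hab] at h'
  exact hk h'

/-- A triple with sum `k` one of whose entries is `k` is `single b k` (plumbing). [cite: Matsumura1987, §27 (pp. 207–209)] -/
theorem eq_single_of_apply_eq {x : Fin 3 → ℕ} {k : ℕ} (hx : ∑ a, x a = k) {b : Fin 3} (hb : x b = k) :
    x = Pi.single b k := by
  funext c
  by_cases hcb : c = b
  · subst hcb
    rw [Pi.single_eq_same, hb]
  · rw [Pi.single_eq_of_ne hcb]
    have hsum := Finset.add_sum_erase Finset.univ x (Finset.mem_univ b)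
    rw [hx, hb] at hsum
    have h0 : ∑ a ∈ Finset.univ.erase b, x a = 0 := by omega
    exact Finset.sum_eq_zero_iff.mp h0 c (Finset.mem_erase.mpr ⟨hcb, Finset.mem_univ c⟩)

/-- A word with a vanishing letter vanishes (plumbing; uses additivity: the outer letters send `0 ↦ 0`).
[cite: Matsumura1987, §27 (pp. 207–209)] -/
theorem word_eq_zero_of_apply_eq_zero {E : ℕ → N →+ N} {x : Fin 3 → ℕ} {b : Fin 3} (h : E (x b) = 0) :
    word E x = 0 := by
  ext f
  fin_cases b <;> simp_all

/-- **The word census** (ours): let `m ∤ k` and `E k′ = 0` for all `k′ < k` with `m ∤ k′`.  Then every word `E_{x 2} E_{x 1} E_{x 0}`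
with `Σ x = k` other than the three SURVIVORS `x = single a k` vanishes: either some index `k′ ∉ mℕ` is `< k` (induction), or all
indices lie in `mℕ ∪ {k}`, and then `m ∤ k` forces exactly one index `= k`, the others `= 0`. [cite: Matsumura1987, §27 (pp. 207–209)] -/
theorem word_eq_zero_of_ne_single {E : ℕ → N →+ N} {m k : ℕ} (hmk : ¬ m ∣ k)
    (ih : ∀ k' < k, ¬ m ∣ k' → E k' = 0) {x : Fin 3 → ℕ} (hx : ∑ a, x a = k)
    (hns : ∀ a, x ≠ Pi.single a k) : word E x = 0 := by
  by_cases h : ∃ b, ¬ m ∣ x b ∧ x b < k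
  · obtain ⟨b, hb, hbk⟩ := h
    exact word_eq_zero_of_apply_eq_zero (ih _ hbk hb)
  · push Not at h
    exfalso
    have hle : ∀ b, x b ≤ k := by
      intro b
      have hsum := Finset.add_sum_erase Finset.univ x (Finset.mem_univ b)
      rw [hx] at hsum
      omega
    by_cases hall : ∀ b, m ∣ x b
    · exact hmk (hx ▸ Finset.dvd_sum fun b _ => hall b)
    · push Not at hall
      obtain ⟨b, hb⟩ := hall
      exact hns b (eq_single_of_apply_eq hx (le_antisymm (hle b) (h b hb)))

/-- **The order-`k` relation collapses to the survivors** (ours): under the census hypotheses,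
`orderComp E l ι k f = u_k • ι (E k f)` with `u_k = powerSum l k`. [cite: Matsumura1987, §27 (pp. 207–209)] -/
theorem orderComp_eq_powerSum_smul {E : ℕ → N →+ N} (hE0 : E 0 = AddMonoidHom.id N) (l : Fin 3 → R) (ι : N →+ M)
    {m k : ℕ} (hmk : ¬ m ∣ k) (ih : ∀ k' < k, ¬ m ∣ k' → E k' = 0) (f : N) :
    orderComp E l ι k f = powerSum l k • ι (E k f) := by
  classical
  have hk0 : k ≠ 0 := by
    rintro rfl
    exact hmk (dvd_zero m)
  set S : Finset (Fin 3 → ℕ) := Finset.univ.image fun a : Fin 3 => (Pi.single a k : Fin 3 → ℕ) with hS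
  have hST : S ⊆ Finset.Nat.antidiagonalTuple 3 k := by
    intro x hx
    obtain ⟨a, -, rfl⟩ := Finset.mem_image.mp hx
    rw [Finset.Nat.mem_antidiagonalTuple]
    exact sum_single k a
  unfold orderComp
  rw [← Finset.sum_subset hST ?_]
  · rw [Finset.sum_image fun a _ b _ hab => single_index_injective hk0 hab]
    simp_rw [mono_single, word_single hE0, ← Finset.sum_smul]
    rfl
  · intro x hx hxS
    rw [Finset.Nat.mem_antidiagonalTuple] at hx
    have hns : ∀ a, x ≠ Pi.single a k := fun a h =>
      hxS (Finset.mem_image.mpr ⟨a, Finset.mem_univ a, h.symm⟩)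
    rw [word_eq_zero_of_ne_single hmk ih hx hns, AddMonoidHom.zero_apply, map_zero, smul_zero]

/-- **FC (B5) CLAIM** (ours): additive operators `E k` on `N` with `E 0 = id`, an injective additive `ι : N → M` into an
`R`-module, scalars `l : Fin 3 → R`.  If the order-`k` component of the triple composite vanishes for every `k ∉ mℕ`
(relation `(E_k)`, from `Θ = id`) and the power sums `u_k = Σ_a (l a)^k` are `M`-regular for `k ∉ mℕ` (cell: `u_k ≠ 0` in the
domain `k[[s]]`, `M = k[[s]][ε]` torsion-free), then `E k = 0` for every `k ∉ mℕ` — i.e. the substitution lies in `k[σ^m][ε]`.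
[cite: Matsumura1987, §27 (pp. 207–209)] -/
theorem map_eq_zero_of_orderComp_eq_zero {E : ℕ → N →+ N} (hE0 : E 0 = AddMonoidHom.id N) {l : Fin 3 → R}
    {ι : N →+ M} (hι : Function.Injective ι) {m : ℕ}
    (hrel : ∀ k, ¬ m ∣ k → ∀ f, orderComp E l ι k f = 0)
    (hu : ∀ k, ¬ m ∣ k → IsSMulRegular M (powerSum l k)) :
    ∀ k, ¬ m ∣ k → E k = 0 := by
  intro k
  induction k using Nat.strong_induction_on with
  | _ k ih =>
    intro hmk
    ext f
    have h0 : powerSum l k • ι (E k f) = 0 := by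
      rw [← orderComp_eq_powerSum_smul hE0 l ι hmk ih f]
      exact hrel k hmk f
    have h1 : ι (E k f) = 0 := (hu k hmk).right_eq_zero_of_smul h0
    rw [AddMonoidHom.zero_apply]
    exact hι (by rw [h1, map_zero])

/-- The same with the relation assumed for every `k ≥ 1` (the form `(E_k)` of THEOREM-FC §4 (B5)) (ours).
[cite: Matsumura1987, §27 (pp. 207–209)] -/
theorem map_eq_zero_of_orderComp_eq_zero' {E : ℕ → N →+ N} (hE0 : E 0 = AddMonoidHom.id N) {l : Fin 3 → R}
    {ι : N →+ M} (hι : Function.Injective ι) {m : ℕ}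
    (hrel : ∀ k, 0 < k → ∀ f, orderComp E l ι k f = 0)
    (hu : ∀ k, ¬ m ∣ k → IsSMulRegular M (powerSum l k)) :
    ∀ k, ¬ m ∣ k → E k = 0 :=
  map_eq_zero_of_orderComp_eq_zero hE0 hι
    (fun k hmk => hrel k (Nat.pos_of_ne_zero (by rintro rfl; exact hmk (dvd_zero m)))) hu

/-- Special case `N = M`, `ι = id` (ours): operators on a module over a commutative ring in which the power sums `u_k`, `k ∉ mℕ`,
are regular. [cite: Matsumura1987, §27 (pp. 207–209)] -/
theorem map_eq_zero_of_orderComp_eq_zero_self {E : ℕ → M →+ M} (hE0 : E 0 = AddMonoidHom.id M) {l : Fin 3 → R} {m : ℕ}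
    (hrel : ∀ k, ¬ m ∣ k → ∀ f, orderComp E l (AddMonoidHom.id M) k f = 0)
    (hu : ∀ k, ¬ m ∣ k → IsSMulRegular M (powerSum l k)) :
    ∀ k, ¬ m ∣ k → E k = 0 :=
  map_eq_zero_of_orderComp_eq_zero hE0 (fun _ _ h => h) hrel hu

end Words

end Literature.AlgebraicGeometry.Resolution.WeightedBlowup.FermatComposition
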